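import Literature.AlgebraicGeometry.Motives.AbelianVarietyInducedActionTwistedCharacter
import HarnessLib

/-!
# Isotypical components of `Ind_H^G Y` at representations on which `H` acts trivially:
# `dim B_W(Ind_H^G Y) = c_W(1) · dim B_H(Y)` and `B_W(Ind_H^G Y) ∼ B_H(Y)^{c_W(1)}`

`X = ⊕_{t ∈ T} Y_t = Ind_H^G (Y, α)` (bicone `b`, `Σ_t π_t ≫ ι_t = 𝟙`; `ρ : G → End X` imprimitive over the transitive `T`,
`H = Stab(t₀)`, `α(h) = ι_{t₀} ρ(h) π_{t₀}`); `B_W(X) = Im u_W`, `u_W = Σ_g c_W(g) ρ(g)` with `|G| e_W = Σ_g c_W(g) g` the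
integral multiple of a rational central idempotent, and `B_H(Y) = Im Σ_h α(h)`.
`Motives/AbelianVarietyInducedActionIsotypical` proved `|H| · 2 dim B_W(Ind_H^G Y) = Σ_{h ∈ H} c_W(h) χ_Y(h)` (Frobenius
reciprocity `⟨Ind χ_Y, W⟩_G = ⟨χ_Y, Res_H W⟩_H`).  When the weight `c_W` is CONSTANT ON `H` — i.e. `H` acts trivially on `W`
(`χ_W(h) = χ_W(1)`), e.g. `H` normal and `W` inflated from `G/H`, or `W = 1` (`c_1 ≡ 1`, the fixed part) — the right side is
`c_W(1) Σ_h χ_Y(h) = c_W(1) · |H| · 2 dim B_H(Y)`, and this file proves (theorems only, no definition):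

* **`dim B_W(Ind_H^G Y) = c_W(1) · dim B_H(Y)`** and **`rk_ℤ Hom(B_W(Ind_H^G Y), B) = c_W(1) · rk_ℤ Hom(B_H(Y), B)`** for
  every `B` (any field), hence over a PERFECT field **`B_W(Ind_H^G Y) ∼ B_H(Y)^{c_W(1)}`** — "`⟨Ind_H^G ψ, W⟩ =
  dim W · ⟨ψ, 1⟩_H` for `W` trivial on `H`"; for `W = 1` this is `B_G(Ind_H^G Y) ∼ B_H(Y)` again;
* over a FINITE field **`Tr(π^m | T_ℓ B_W(Ind_H^G Y)) = c_W(1) · Tr(π^m | T_ℓ B_H(Y))`** for all `m` (equal point counts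
  of `B_W(Ind Y)` and `B_H(Y)^{c_W(1)}` over every `𝔽_{q^m}`).

## References

* [SerreLinearRepresentations1977] J.-P. Serre, *Linear Representations of Finite Groups*, GTM 42 (1977): §7.2 Thm. 13
  (Frobenius reciprocity), §3.3 Example 2 / Ex. 7.2 (`Ind_H^G 1` is the permutation representation on `G/H`).  Held:
  `book:serre1977-linear-representations-finite-groups`, PDF pp. 30, 50–51 read 2026-08-28.
* [LangeRodriguez2022] H. Lange, R. E. Rodríguez, *Decomposition of Jacobians by Prym Varieties*, LNM 2310 (2022), §2.9.1
  Thm. 2.9.1, Prop. 2.9.3 (`dim B_W = ½ ⟨ρ_r, W⟩ dim`, PDF pp. 43, 46).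
* [KaniRosen1989] E. Kani, M. Rosen, *Idempotent relations and factors of Jacobians*, Math. Ann. 284 (1989), §2, §3 Thm. B.
* [Milne1986AbelianVarieties] J. S. Milne, *Abelian Varieties* (1986), §12 (p. 122).
* [MumfordAV1970] D. Mumford, *Abelian Varieties* (1970), §19 Thm. 4 (p. 180: characteristic polynomial of Frobenius on `T_ℓ`).
-/

noncomputable section

open CategoryTheory CategoryTheory.Limits MulAction
open Literature.NumberTheory.DiophantineGeometry Literature.RepresentationTheory.FiniteGroups

universe u

namespace Literature.AlgebraicGeometry.Motives

namespace AbelianVariety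

namespace Imprimitive

variable {K : Type u} [Field K]

section Inflation

variable {Y : AbelianVariety K} (B : AbelianVariety K) {T : Type} [Fintype T] (b : Bicone (fun _ : T ↦ Y))
  {G : Type} [Group G] [Fintype G] [MulAction G T] [IsPretransitive G T] (ρ : G →* End b.pt) (t₀ : T)
  [Fintype (stabilizer G t₀)] (α : stabilizer G t₀ →* End Y)
  {c : ratCharIdempotents G → G → ℤ}
  (hc : ∀ e : ratCharIdempotents G,
    (Fintype.card G : ℚ) • (e : MonoidAlgebra ℚ G) = ∑ g, (c e g : ℚ) • MonoidAlgebra.of ℚ G g)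
  {u : ratCharIdempotents G → (b.pt ⟶ b.pt)} (hu : ∀ e, End.of (u e) = ∑ g, c e g • ρ g)

include hc hu

/-- **`dim B_W(Ind_H^G Y) = c_W(1) · dim B_H(Y)` when `c_W` is constant on `H`** (`H` acts trivially on `W`; any field):
`|H| · 2 dim B_W(Ind Y) = Σ_h c_W(h) χ_Y(h) = c_W(1) Σ_h χ_Y(h) = c_W(1) · |H| · 2 dim B_H(Y)` (`B_H(Y) = Im Σ_h α(h)`).
[cite: SerreLinearRepresentations1977, §7.2 Thm. 13] [cite: LangeRodriguez2022, §2.9.1 Prop. 2.9.3 (PDF p. 46)] -/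
theorem natCast_dim_isotypical_eq_mul_of_isotypicalCoeff_const (hb : ∑ t, b.π t ≫ b.ι t = 𝟙 b.pt)
    (hρ : ∀ (g : G) (t u : T), g • t ≠ u → b.ι t ≫ End.asHom (ρ g) ≫ b.π u = 0)
    (hα : ∀ h : stabilizer G t₀, End.asHom (α h) = b.ι t₀ ≫ End.asHom (ρ h) ≫ b.π t₀) (e : ratCharIdempotents G)
    (hcH : ∀ h : stabilizer G t₀, c e h = c e 1) {NH : Y ⟶ Y} (hNH : End.of NH = ∑ h : stabilizer G t₀, α h) :
    ((image (u e)).dim : ℤ) = c e 1 * (image NH).dim := by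
  obtain ⟨ℓ', hℓ'p, hℓ'⟩ := exists_prime_natCast_ne_zero (K := K)
  haveI : Fact ℓ'.Prime := ⟨hℓ'p⟩
  have key := card_stabilizer_mul_two_mul_dim_isotypical_eq_sum ℓ' b ρ t₀ α hc hu hb hρ hℓ' hα e
  rw [Finset.sum_congr rfl (fun h _ ↦ by rw [hcH h] : ∀ h ∈ (Finset.univ : Finset (stabilizer G t₀)),
      (c e h : ℤ_[ℓ']) * LinearMap.trace ℤ_[ℓ'] (Y.tateModule ℓ') (tateModuleMap ℓ' (End.asHom (α h))) =
        (c e 1 : ℤ_[ℓ']) * LinearMap.trace ℤ_[ℓ'] (Y.tateModule ℓ') (tateModuleMap ℓ' (End.asHom (α h)))),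
    ← Finset.mul_sum, ← card_mul_two_mul_dim_image_normG_eq_sum_trace_tateModuleMap ℓ' α hNH hℓ'] at key
  have key' : (((Fintype.card (stabilizer G t₀) * 2 : ℕ) : ℤ) : ℤ_[ℓ']) * (((image (u e)).dim : ℤ) : ℤ_[ℓ']) =
      (((Fintype.card (stabilizer G t₀) * 2 : ℕ) : ℤ) : ℤ_[ℓ']) * ((c e 1 * (image NH).dim : ℤ) : ℤ_[ℓ']) := by
    push_cast at key ⊢
    linear_combination key
  have key'' : ((Fintype.card (stabilizer G t₀) * 2 : ℕ) : ℤ) * ((image (u e)).dim : ℤ) =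
      ((Fintype.card (stabilizer G t₀) * 2 : ℕ) : ℤ) * (c e 1 * (image NH).dim) := by
    exact_mod_cast key'
  exact mul_left_cancel₀ (Nat.cast_ne_zero.2 (mul_ne_zero Fintype.card_ne_zero two_ne_zero)) key''

/-- **`rk_ℤ Hom(B_W(Ind_H^G Y), B) = c_W(1) · rk_ℤ Hom(B_H(Y), B)` for every `B` when `c_W` is constant on `H`** (any field).
[cite: SerreLinearRepresentations1977, §7.2 Thm. 13] [cite: LangeRodriguez2022, §2.9.1 Thm. 2.9.1 and Prop. 2.9.3]
[cite: KaniRosen1989, §2] -/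
theorem natCast_finrank_hom_isotypical_eq_mul_of_isotypicalCoeff_const (hb : ∑ t, b.π t ≫ b.ι t = 𝟙 b.pt)
    (hρ : ∀ (g : G) (t u : T), g • t ≠ u → b.ι t ≫ End.asHom (ρ g) ≫ b.π u = 0)
    (hα : ∀ h : stabilizer G t₀, End.asHom (α h) = b.ι t₀ ≫ End.asHom (ρ h) ≫ b.π t₀) (e : ratCharIdempotents G)
    (hcH : ∀ h : stabilizer G t₀, c e h = c e 1) {NH : Y ⟶ Y} (hNH : End.of NH = ∑ h : stabilizer G t₀, α h) :
    (Module.finrank ℤ (image (u e) ⟶ B) : ℤ) = c e 1 * Module.finrank ℤ (image NH ⟶ B) := by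
  have key := card_stabilizer_mul_finrank_hom_isotypical_eq_sum B b ρ t₀ α hc hu hb hρ hα e
  have h2 := trace_leftComp_eq_mul_finrank B (normG_comp_normG_eq_card_nsmul α hNH)
  have hNH' : NH = ∑ h : stabilizer G t₀, (1 : ℤ) • End.asHom (α h) := by
    rw [Finset.sum_congr rfl fun h _ ↦ one_zsmul (End.asHom (α h))]; exact hNH
  have hs2 : LinearMap.trace ℤ (Y ⟶ B) (Preadditive.leftComp B NH).toIntLinearMap =
      ∑ h : stabilizer G t₀, LinearMap.trace ℤ (Y ⟶ B) (Preadditive.leftComp B (End.asHom (α h))).toIntLinearMap := by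
    conv_lhs => rw [hNH']
    rw [trace_leftComp_sum_zsmul]
    exact Finset.sum_congr rfl fun h _ ↦ one_mul _
  rw [Finset.sum_congr rfl (fun h _ ↦ by rw [hcH h] : ∀ h ∈ (Finset.univ : Finset (stabilizer G t₀)),
      c e h * LinearMap.trace ℤ (Y ⟶ B) (Preadditive.leftComp B (End.asHom (α h))).toIntLinearMap =
        c e 1 * LinearMap.trace ℤ (Y ⟶ B) (Preadditive.leftComp B (End.asHom (α h))).toIntLinearMap),
    ← Finset.mul_sum, ← hs2, h2, mul_left_comm] at key
  exact mul_left_cancel₀ (Nat.cast_ne_zero.2 Fintype.card_ne_zero) key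

omit [Fintype T] [Fintype G] [IsPretransitive G T] [Fintype (stabilizer G t₀)] hc hu in
/-- `rk Hom(⨁_{Fin n} A, B) = n · rk Hom(A, B)` in `ℤ`, with `n = m.toNat` for an integer `m` such that `r = m · rk Hom(A, B)` is a
rank (so `m < 0` forces `rk Hom(A, B) = 0`; private helper). [folklore] -/
private theorem natCast_finrank_hom_biproduct_toNat_eq (A : AbelianVariety K) (m : ℤ) {r : ℕ}
    (hr : (r : ℤ) = m * Module.finrank ℤ (A ⟶ B)) :
    (Module.finrank ℤ ((⨁ fun _ : Fin m.toNat ↦ A) ⟶ B) : ℤ) = r := by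
  rw [finrank_hom_biproduct_const, Fintype.card_fin, hr, Nat.cast_mul]
  rcases le_or_gt 0 m with hm | hm
  · rw [Int.toNat_of_nonneg hm]
  · have h0 : (Module.finrank ℤ (A ⟶ B) : ℤ) = 0 := by
      have h1 : (0 : ℤ) ≤ r := Nat.cast_nonneg r
      rw [hr] at h1
      nlinarith [Nat.cast_nonneg (α := ℤ) (Module.finrank ℤ (A ⟶ B))]
    rw [h0, mul_zero, mul_zero]

/-- **`B_W(Ind_H^G Y) ∼ B_H(Y)^{c_W(1)}` over a perfect field when `c_W` is constant on `H`** (`H` acts trivially on `W`; e.g.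
`W` inflated from `G/H` for `H` normal, or `W = 1`): both sides have `rk Hom(−, B) = c_W(1) · rk Hom(B_H(Y), B)` for every `B`.
[cite: SerreLinearRepresentations1977, §7.2 Thm. 13] [cite: LangeRodriguez2022, §2.9.1 Prop. 2.9.3 and §3.5]
[cite: KaniRosen1989, §3 Thm. B] [cite: Milne1986AbelianVarieties, §12 p. 122] -/
theorem isIsogenous_isotypical_biproduct_image_norm_of_isotypicalCoeff_const [PerfectField K]
    (hb : ∑ t, b.π t ≫ b.ι t = 𝟙 b.pt)
    (hρ : ∀ (g : G) (t u : T), g • t ≠ u → b.ι t ≫ End.asHom (ρ g) ≫ b.π u = 0)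
    (hα : ∀ h : stabilizer G t₀, End.asHom (α h) = b.ι t₀ ≫ End.asHom (ρ h) ≫ b.π t₀) (e : ratCharIdempotents G)
    (hcH : ∀ h : stabilizer G t₀, c e h = c e 1) {NH : Y ⟶ Y} (hNH : End.of NH = ∑ h : stabilizer G t₀, α h) :
    IsIsogenous (image (u e)) (⨁ fun _ : Fin (c e 1).toNat ↦ image NH) := by
  refine isIsogenous_iff_forall_finrank_hom_eq'.2 fun B ↦ ?_
  exact_mod_cast (natCast_finrank_hom_biproduct_toNat_eq B (image NH) (c e 1)
    (natCast_finrank_hom_isotypical_eq_mul_of_isotypicalCoeff_const B b ρ t₀ α hc hu hb hρ hα e hcH hNH)).symm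

end Inflation

/-! ## Over a finite field: `Tr(π^m | B_W(Ind_H^G Y)) = c_W(1) · Tr(π^m | B_H(Y))` -/

section Frobenius

variable [Finite K] (ℓ : ℕ) [Fact ℓ.Prime] {Y : AbelianVariety K} {T : Type} [Fintype T] (b : Bicone (fun _ : T ↦ Y))
  {G : Type} [Group G] [Fintype G] [MulAction G T] [IsPretransitive G T] (ρ : G →* End b.pt) (t₀ : T)
  [Fintype (stabilizer G t₀)] (α : stabilizer G t₀ →* End Y)
  {c : ratCharIdempotents G → G → ℤ}
  (hc : ∀ e : ratCharIdempotents G,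
    (Fintype.card G : ℚ) • (e : MonoidAlgebra ℚ G) = ∑ g, (c e g : ℚ) • MonoidAlgebra.of ℚ G g)
  {u : ratCharIdempotents G → (b.pt ⟶ b.pt)} (hu : ∀ e, End.of (u e) = ∑ g, c e g • ρ g)

/-- `T_ℓ(π_X^m ≫ f) = T_ℓ f ∘ T_ℓ(π_X)^m` (functoriality; private helper). [cite: MumfordAV1970, §19 Thm. 3 (p. 176)] -/
private theorem tateModuleMap_frobeniusHom_pow_comp'' {X Z : AbelianVariety K} (f : X ⟶ Z) (m : ℕ) :
    tateModuleMap ℓ (((End.of (frobeniusHom X) ^ m : End X) : X ⟶ X) ≫ f) =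
      tateModuleMap ℓ f ∘ₗ tateModuleMap ℓ (frobeniusHom X) ^ m := by
  rw [tateModuleMap_comp, tateModuleMap_end_pow]

include hc hu

/-- **`Tr(π^m | T_ℓ B_W(Ind_H^G Y)) = c_W(1) · Tr(π^m | T_ℓ B_H(Y))` over a finite field when `c_W` is constant on `H`**
(`π` the Frobenius, `ℓ ∤ q`, all `m`): `|H| Tr(π^m | B_W(Ind Y)) = Σ_h c_W(h) Tr(α(h) π_Y^m)`
(`Motives/AbelianVarietyInducedActionTwistedCharacter`) `= c_W(1) Tr(π_Y^m Σ_h α(h)) = c_W(1) · |H| · Tr(π^m | B_H(Y))` — so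
`B_W(Ind_H^G Y)` and `B_H(Y)^{c_W(1)}` have the same number of `𝔽_{q^m}`-points for all `m`.
[cite: SerreLinearRepresentations1977, §7.2 Thm. 13] [cite: LangeRodriguez2022, §2.9.1 Prop. 2.9.3]
[cite: MumfordAV1970, §19 Thm. 4 (p. 180)] -/
theorem trace_frobeniusHom_pow_isotypical_eq_mul_of_isotypicalCoeff_const (hb : ∑ t, b.π t ≫ b.ι t = 𝟙 b.pt)
    (hρ : ∀ (g : G) (t u : T), g • t ≠ u → b.ι t ≫ End.asHom (ρ g) ≫ b.π u = 0) (hℓ : (ℓ : K) ≠ 0)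
    (hα : ∀ h : stabilizer G t₀, End.asHom (α h) = b.ι t₀ ≫ End.asHom (ρ h) ≫ b.π t₀) (e : ratCharIdempotents G)
    (hcH : ∀ h : stabilizer G t₀, c e h = c e 1) {NH : Y ⟶ Y} (hNH : End.of NH = ∑ h : stabilizer G t₀, α h) (m : ℕ) :
    LinearMap.trace ℤ_[ℓ] ((image (u e)).tateModule ℓ) (tateModuleMap ℓ (frobeniusHom (image (u e))) ^ m) =
      (c e 1 : ℤ_[ℓ]) * LinearMap.trace ℤ_[ℓ] ((image NH).tateModule ℓ) (tateModuleMap ℓ (frobeniusHom (image NH)) ^ m) := by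
  have key := card_stabilizer_mul_trace_frobeniusHom_pow_isotypical_eq_sum_of_induced ℓ b ρ t₀ α hc hu hb hρ hℓ hα e m
  have hH := trace_tateModuleMap_frobeniusHom_pow_comp_eq ℓ (normG_comp_normG_eq_card_nsmul α hNH) hℓ m
  have hNH' : NH = ∑ h : stabilizer G t₀, End.asHom (α h) := hNH
  have hsH : LinearMap.trace ℤ_[ℓ] (Y.tateModule ℓ)
      (tateModuleMap ℓ (((End.of (frobeniusHom Y) ^ m : End Y) : Y ⟶ Y) ≫ NH)) =
      ∑ h : stabilizer G t₀, LinearMap.trace ℤ_[ℓ] (Y.tateModule ℓ)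
        (tateModuleMap ℓ (End.asHom (α h)) ∘ₗ tateModuleMap ℓ (frobeniusHom Y) ^ m) := by
    conv_lhs => rw [hNH', Preadditive.comp_sum, tateModuleMap_sum, map_sum]
    simp only [tateModuleMap_frobeniusHom_pow_comp'']
  rw [Finset.sum_congr rfl (fun h _ ↦ by rw [hcH h] : ∀ h ∈ (Finset.univ : Finset (stabilizer G t₀)),
      (c e h : ℤ_[ℓ]) * LinearMap.trace ℤ_[ℓ] (Y.tateModule ℓ)
          (tateModuleMap ℓ (End.asHom (α h)) ∘ₗ tateModuleMap ℓ (frobeniusHom Y) ^ m) =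
        (c e 1 : ℤ_[ℓ]) * LinearMap.trace ℤ_[ℓ] (Y.tateModule ℓ)
          (tateModuleMap ℓ (End.asHom (α h)) ∘ₗ tateModuleMap ℓ (frobeniusHom Y) ^ m)),
    ← Finset.mul_sum, ← hsH, hH, mul_left_comm] at key
  exact mul_left_cancel₀ (Nat.cast_ne_zero.2 Fintype.card_ne_zero) key

end Frobenius

end Imprimitive

end AbelianVariety

end Literature.AlgebraicGeometry.Motives
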